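import Literature.NumberTheory.LFunctions.LiouvilleOneSided
import Literature.NumberTheory.LFunctions.LiouvilleOneSidedSimpleZeros
import Literature.NumberTheory.LFunctions.ZetaRealAxis
import HarnessLib

/-!
# One-sided bounds `±L(x) ≤ A√x`: simple zeros and the residue bound `|ζ(2ρ)/(ρζ'(ρ))| ≤ 2A ∓ 1/ζ(½)` (Landau's "strong corollary")

Topic `Literature/NumberTheory/LFunctions`. Everything here is PROVED. With `L(x) = ∑_{n ≤ x} λ(n)`
(the tree's `liouvilleSum`) and its Mellin transform `F(s) = ∫_1^∞ L(x) x^{-s-1} dx = ζ(2s)/(sζ(s))`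
(`LiouvilleOneSided.lean`): if `η L(x) ≤ A√x` for all `x ≥ x₁` (`η = ±1`, `A ≥ 0`), then

* `norm_mellin_liouville_le_of_oneSided_from` — for `½ < Re s < 1`,
  `‖F(s)‖ ≤ 2A/(Re s − ½) − η·ζ(2σ)/(σζ(σ)) + 4(A+1)·max(x₁,1)` (`σ = Re s`): the transform of
  `|L| ≤ |g| + A√x`, `g = A√x − ηL ≥ 0` beyond `x₁`, is dominated by its value at the real point
  (the step "`|r| ≤ lim (σ − σ₀) ∫ g₁ x^{-σ} dx/x ≤ c`" of Anderson–Stark's proof of the Strong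
  Corollary of Landau's theorem, §2; Odlyzko–te Riele (2.2) for `M`). The sibling
  `LiouvilleOneSidedSimpleZeros.lean` has the variant `norm_mellin_liouville_le_of_oneSided` (bound
  on `[1, ∞)`, unsigned real term `|ζ(2σ)/(σζ(σ))|`); the signed form from `x₁` with its explicit
  additive constant is what the residue limit below consumes.
* `tendsto_mul_zetaQuot_real` — `u · ζ(1+2u)/((½+u)ζ(½+u)) → 1/ζ(½)` as `u → 0⁺` (the residue of
  `F` at `s = ½`; Mathlib's `riemannZeta_residue_one`).
* `liouville_oneSided_zeros` — **the strong corollary for `L`**: every zero `ρ` of `ζ` with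
  `0 < Re ρ < 1` lies on the line (the tree's `zetaZero_re_eq_half_of_liouville_oneSided`), is
  SIMPLE (re-derived here from the limit; the qualitative statement is the tree's
  `zetaZeros_simple_onLine_of_liouville_oneSided`), and — the new content of this file — its
  residue is bounded uniformly:
  `‖ζ(2ρ)/(ρ ζ'(ρ))‖ ≤ 2A − η/ζ(½)`. At `s = ρ + u` (`u → 0⁺`), `ζ(2s) = F(s)·sζ(s)`
  (`mellin_liouville_mul_eq`) and the norm bound give
  `‖ζ(2s)‖ ≤ (2A − η·u ζ(2σ)/(σζ(σ)) + O(u))·‖s‖·‖ζ(s)‖/u`, whose limit is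
  `‖ζ(2ρ)‖ ≤ (2A − η/ζ(½))·‖ρ‖·‖ζ'(ρ)‖` with `ζ(2ρ) = ζ(1 + 2iγ) ≠ 0`.
  Borwein–Ferguson–Mossinghoff 2008, §1 (p. 1682): "Ingham noted that the Riemann hypothesis,
  and the simplicity of the zeros of `ζ(s)` follow more generally if either `L(n) < c√n` or
  `L(n) > −c√n`"; Anderson–Stark §2, Strong Corollary ("`limsup g(x)/x^{σ₀} ≥ |r|`"), and §4,
  proof of Theorem 1 ("By Landau's theorem, we may assume that … any pole of `G(s)` on the line
  `σ = σ₀` is a first order pole … Again by Landau's theorem, we may assume `r_γ = O(1)`").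
* `liouville_oneSided_zeros_below`, `liouville_oneSided_residue_le` — the packaged forms: the zero
  clause of Ingham's kernel theorem (`ZetaQuotientKernelTheorem.lean`) at every height, and the
  uniform residue bound, under a one-sided bound on `L`.

The case `A = 0`, `η = 1` (eventually `L ≤ 0`) with explicit real-axis constants is
`LiouvilleOneSidedZeros.lean`, and the simplicity for general `A` (Mossinghoff–Trudgian Thm. 2.4,
`α = 0`) is `LiouvilleOneSidedSimpleZeros.lean`; what this file adds is the QUANTITATIVE residue
bound (the constant at the pole obtained as a limit), the input "`r_γ = O(1)`" of Anderson–Stark's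
Theorem 1 for `L`.

## References

* [AndersonStark1981] R. J. Anderson, H. M. Stark, *Oscillation theorems*, LNM 899 (1981) — §2
  (Landau's Theorem, Weak and Strong Corollary), §4 Theorem 1 (first lines of the proof) (read).
* [BorweinFergusonMossinghoff2008] P. Borwein, R. Ferguson, M. J. Mossinghoff, *Sign changes in
  sums of the Liouville function*, Math. Comp. 77 (2008) — §1, p. 1682 (Ingham 1942) (read).
* [OdlyzkoTeRiele1985] A. M. Odlyzko, H. J. J. te Riele, *Disproof of the Mertens conjecture*,
  J. reine angew. Math. 357 (1985) — §2 (2.2) (the argument for `M`, through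
  `MertensConjectureOneSidedZeros.lean`).
-/

noncomputable section

open Complex Filter Asymptotics MeasureTheory Set
open scoped Real Topology

namespace Literature.NumberTheory.LFunctions

section OneSided

variable {A x₁ η : ℝ}

/-- `∫_{(1,∞)} √x · x^{-(σ+1)} dx = 1/(σ - ½)` (real form) for `σ > ½`. [folklore] -/
theorem setIntegral_sqrt_mul_rpow {σ : ℝ} (hσ : 1 / 2 < σ) :
    ∫ x in Ioi (1 : ℝ), Real.sqrt x * x ^ (-(σ + 1)) = 1 / (σ - 1 / 2) := by
  have heq : EqOn (fun x : ℝ ↦ Real.sqrt x * x ^ (-(σ + 1))) (fun x : ℝ ↦ x ^ (-(σ + 1 / 2)))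
      (Ioi 1) := by
    intro x hx
    have hx0 : 0 < x := by simp only [mem_Ioi] at hx; linarith
    simp only
    rw [Real.sqrt_eq_rpow, ← Real.rpow_add hx0]
    congr 1; ring
  rw [setIntegral_congr_fun measurableSet_Ioi heq, integral_Ioi_rpow_of_lt (by linarith) zero_lt_one,
    Real.one_rpow]
  have : -(σ + 1 / 2) + 1 = -(σ - 1 / 2) := by ring
  rw [this, neg_div_neg_eq]

/-- The real Mellin integral of `L` at a real point `σ > ½`, `σ ≠ 1`, under absolute convergence:
`∫_1^∞ L(x) x^{-σ-1} dx = Re (ζ(2σ)/(σζ(σ)))`. [folklore] -/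
theorem setIntegral_liouville_rpow_eq_re
    (hI : ∀ σ : ℝ, 1 / 2 < σ → IntegrableOn (fun x ↦ (liouvilleSum x : ℝ) * x ^ (-(σ + 1))) (Ioi 1))
    {σ : ℝ} (hσ : 1 / 2 < σ) (hσ1 : σ ≠ 1) :
    ∫ x in Ioi (1 : ℝ), (liouvilleSum x : ℝ) * x ^ (-(σ + 1)) =
      (riemannZeta (2 * σ) / ((σ : ℂ) * riemannZeta σ)).re := by
  have hσ1' : (σ : ℂ) ≠ 1 := by exact_mod_cast hσ1
  have hmel := mellin_liouville_eq_of_integrable hI (s := (σ : ℂ)) (by simpa using hσ) hσ1'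
  have hreal : (((∫ x in Ioi (1 : ℝ), (liouvilleSum x : ℝ) * x ^ (-(σ + 1)) : ℝ)) : ℂ) =
      riemannZeta (2 * σ) / ((σ : ℂ) * riemannZeta σ) := by
    rw [← hmel, ← Landau.mellinIoiLog_zero, Landau.mellinIoiLog_ofReal]
    simp
  rw [← hreal, Complex.ofReal_re]

/-- **The transform is dominated by the real point** (Anderson–Stark §2, proof of the Strong
Corollary; Odlyzko–te Riele (2.2) for `M`): if `ηL(x) ≤ A√x` for `x ≥ x₁` (`η = ±1`, `A ≥ 0`),
then for `½ < Re s < 1`, writing `σ = Re s`,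
`‖∫_1^∞ L(x) x^{-s-1} dx‖ ≤ 2A/(σ − ½) − η · Re(ζ(2σ)/(σζ(σ))) + 4(A+1)·max(x₁, 1)`.
Indeed `|L| ≤ A√x + |g|` with `g = A√x − ηL`, `|g| = g` beyond `max(x₁,1)` and `|g| − g ≤ 2(A+1)max(x₁,1)`
before, and `∫_1^∞ g x^{-σ-1} = A/(σ−½) − η ∫_1^∞ L x^{-σ-1} = A/(σ−½) − η Re(ζ(2σ)/(σζ(σ)))`.
[cite: AndersonStark1981, §2 (proof of the Strong Corollary)] -/
theorem norm_mellin_liouville_le_of_oneSided_from (hη : η = 1 ∨ η = -1) (hA : 0 ≤ A)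
    (hb : ∀ x, x₁ ≤ x → η * (liouvilleSum x : ℝ) ≤ A * Real.sqrt x)
    {s : ℂ} (hs1 : 1 / 2 < s.re) (hs2 : s.re < 1) :
    ‖Landau.mellinIoi (fun x ↦ (liouvilleSum x : ℝ)) s‖ ≤
      2 * A / (s.re - 1 / 2) - η * (riemannZeta (2 * (s.re : ℂ)) / ((s.re : ℂ) * riemannZeta s.re)).re
        + 4 * (A + 1) * max x₁ 1 := by
  have hηabs : |η| = 1 := by rcases hη with rfl | rfl <;> norm_num
  set x₂ : ℝ := max x₁ 1 with hx₂
  have hx₂1 : 1 ≤ x₂ := le_max_right _ _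
  have hI : ∀ σ : ℝ, 1 / 2 < σ →
      IntegrableOn (fun x ↦ (liouvilleSum x : ℝ) * x ^ (-(σ + 1))) (Ioi 1) :=
    fun σ hσ ↦ integrableOn_liouville_rpow_of_oneSided hη hb hσ
  set σ : ℝ := s.re with hσdef
  have hσ : 1 / 2 < σ := hs1
  have hσ1 : σ < 1 := hs2
  have hσ0 : 0 < σ := by linarith
  have hIσ := hI σ hσ
  -- the defect `g = A√x - ηL`
  set g : ℝ → ℝ := fun x ↦ A * Real.sqrt x - η * (liouvilleSum x : ℝ) with hg
  have hgpos : ∀ x, x₂ ≤ x → 0 ≤ g x := fun x hx ↦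
    sub_nonneg.2 (hb x ((le_max_left _ _).trans hx))
  -- (1) `‖F(s)‖ ≤ ∫ |L| x^{-σ-1}`
  have hnorm : ‖Landau.mellinIoi (fun x ↦ (liouvilleSum x : ℝ)) s‖ ≤
      ∫ x in Ioi (1 : ℝ), |(liouvilleSum x : ℝ)| * x ^ (-(σ + 1)) :=
    Landau.norm_mellinIoi_le (le_of_eq hσdef.symm) hIσ
  -- integrability of the pieces
  have hpow_int : IntegrableOn (fun x : ℝ ↦ x ^ (-(σ + 1))) (Ioi 1) :=
    integrableOn_Ioi_rpow_of_lt (by linarith : -(σ + 1) < -1) zero_lt_one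
  have hsqrt_int : IntegrableOn (fun x : ℝ ↦ Real.sqrt x * x ^ (-(σ + 1))) (Ioi 1) :=
    integrableOn_sqrt_mul_rpow hσ
  have habs_int : IntegrableOn (fun x ↦ |(liouvilleSum x : ℝ)| * x ^ (-(σ + 1))) (Ioi 1) := by
    refine hIσ.norm.congr ?_
    rw [Filter.EventuallyEq, ae_restrict_iff' measurableSet_Ioi]
    refine Eventually.of_forall fun x (hx : 1 < x) ↦ ?_
    have hx0 : 0 < x := zero_lt_one.trans hx
    rw [norm_mul, Real.norm_eq_abs, Real.norm_eq_abs, abs_of_pos (Real.rpow_pos_of_pos hx0 _)]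
  -- the majorant `h = g x^{-σ-1} + A √x x^{-σ-1} + 2(A+1)x₂ x^{-σ-1}`
  set h : ℝ → ℝ := fun x ↦ (A * (Real.sqrt x * x ^ (-(σ + 1))) - η * ((liouvilleSum x : ℝ) * x ^ (-(σ + 1))))
    + A * (Real.sqrt x * x ^ (-(σ + 1))) + 2 * (A + 1) * x₂ * x ^ (-(σ + 1)) with hh
  have hh_int : IntegrableOn h (Ioi 1) :=
    (((hsqrt_int.const_mul A).sub (hIσ.const_mul η)).add (hsqrt_int.const_mul A)).add
      (hpow_int.const_mul _)
  have hptw : ∀ x ∈ Ioi (1 : ℝ), |(liouvilleSum x : ℝ)| * x ^ (-(σ + 1)) ≤ h x := by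
    intro x hx
    have hx1 : 1 < x := hx
    have hx0 : 0 < x := by linarith
    have hpow : 0 < x ^ (-(σ + 1)) := Real.rpow_pos_of_pos hx0 _
    have hsx1 : 1 ≤ Real.sqrt x := Real.one_le_sqrt.mpr hx1.le
    have hsx : Real.sqrt x ≤ x := by
      nlinarith [Real.mul_self_sqrt hx0.le, Real.sqrt_nonneg x]
    -- `|L| ≤ A√x + |g|`
    have hLg : |(liouvilleSum x : ℝ)| ≤ A * Real.sqrt x + |g x| := by
      have h1 : |(liouvilleSum x : ℝ)| = |η * (liouvilleSum x : ℝ)| := by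
        rw [abs_mul, hηabs, one_mul]
      have h2 : η * (liouvilleSum x : ℝ) = A * Real.sqrt x - g x := by simp only [hg]; ring
      rw [h1, h2]
      calc |A * Real.sqrt x - g x| ≤ |A * Real.sqrt x| + |g x| := abs_sub _ _
        _ = A * Real.sqrt x + |g x| := by rw [abs_of_nonneg (by positivity)]
    -- `|g| ≤ g + 2(A+1)x₂`
    have hgabs : |g x| ≤ g x + 2 * (A + 1) * x₂ := by
      rcases le_or_gt x₂ x with hxx | hxx
      · rw [abs_of_nonneg (hgpos x hxx)]
        have : 0 ≤ 2 * (A + 1) * x₂ := by positivity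
        linarith
      · have hgx : |g x| ≤ (A + 1) * x₂ := by
          simp only [hg]
          calc |A * Real.sqrt x - η * (liouvilleSum x : ℝ)|
              ≤ |A * Real.sqrt x| + |η * (liouvilleSum x : ℝ)| := abs_sub _ _
            _ = A * Real.sqrt x + |(liouvilleSum x : ℝ)| := by
                rw [abs_mul η, hηabs, one_mul, abs_of_nonneg (by positivity)]
            _ ≤ A * x + x := add_le_add (mul_le_mul_of_nonneg_left hsx hA)
                (abs_liouvilleSum_le hx0.le)
            _ = (A + 1) * x := by ring
            _ ≤ (A + 1) * x₂ := mul_le_mul_of_nonneg_left hxx.le (by positivity)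
        have : -|g x| ≤ g x := neg_abs_le _
        linarith
    have hmain : |(liouvilleSum x : ℝ)| ≤ g x + A * Real.sqrt x + A * Real.sqrt x - A * Real.sqrt x
        + 2 * (A + 1) * x₂ := by linarith
    have : |(liouvilleSum x : ℝ)| * x ^ (-(σ + 1)) ≤
        (g x + A * Real.sqrt x + 2 * (A + 1) * x₂) * x ^ (-(σ + 1)) :=
      mul_le_mul_of_nonneg_right (by linarith) hpow.le
    refine this.trans (le_of_eq ?_)
    simp only [hh, hg]
    ring
  have hmono := setIntegral_mono_on habs_int hh_int measurableSet_Ioi hptw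
  -- evaluate `∫ h`
  have hIreal := setIntegral_liouville_rpow_eq_re hI hσ hσ1.ne
  have hsq := setIntegral_sqrt_mul_rpow hσ
  have hpw : ∫ x in Ioi (1 : ℝ), x ^ (-(σ + 1)) = 1 / σ := by
    rw [integral_Ioi_rpow_of_lt (by linarith) zero_lt_one, Real.one_rpow]
    have : -(σ + 1) + 1 = -σ := by ring
    rw [this, neg_div_neg_eq]
  have hh_val : ∫ x in Ioi (1 : ℝ), h x =
      (A * (1 / (σ - 1 / 2)) - η * (riemannZeta (2 * (σ : ℂ)) / ((σ : ℂ) * riemannZeta σ)).re)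
        + A * (1 / (σ - 1 / 2)) + 2 * (A + 1) * x₂ * (1 / σ) := by
    simp only [hh]
    have i1 : Integrable (fun x ↦ A * (Real.sqrt x * x ^ (-(σ + 1)))) (volume.restrict (Ioi 1)) :=
      hsqrt_int.const_mul A
    have i2 : Integrable (fun x ↦ η * ((liouvilleSum x : ℝ) * x ^ (-(σ + 1))))
        (volume.restrict (Ioi 1)) := hIσ.const_mul η
    have i3 : Integrable (fun x : ℝ ↦ 2 * (A + 1) * x₂ * x ^ (-(σ + 1))) (volume.restrict (Ioi 1)) :=
      hpow_int.const_mul _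
    have i12 : Integrable (fun x ↦ A * (Real.sqrt x * x ^ (-(σ + 1))) -
        η * ((liouvilleSum x : ℝ) * x ^ (-(σ + 1)))) (volume.restrict (Ioi 1)) := i1.sub i2
    have i121 : Integrable (fun x ↦ A * (Real.sqrt x * x ^ (-(σ + 1))) -
        η * ((liouvilleSum x : ℝ) * x ^ (-(σ + 1))) + A * (Real.sqrt x * x ^ (-(σ + 1))))
        (volume.restrict (Ioi 1)) := i12.add i1
    rw [integral_add i121 i3, integral_add i12 i1, integral_sub i1 i2,
      integral_const_mul, integral_const_mul, integral_const_mul, hsq, hIreal, hpw]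
  -- assemble
  have h2x : 2 * (A + 1) * x₂ * (1 / σ) ≤ 4 * (A + 1) * x₂ := by
    rw [mul_one_div, div_le_iff₀ hσ0]
    have : 0 ≤ (A + 1) * x₂ := by positivity
    nlinarith
  calc ‖Landau.mellinIoi (fun x ↦ (liouvilleSum x : ℝ)) s‖
      ≤ ∫ x in Ioi (1 : ℝ), |(liouvilleSum x : ℝ)| * x ^ (-(σ + 1)) := hnorm
    _ ≤ ∫ x in Ioi (1 : ℝ), h x := hmono
    _ = (A * (1 / (σ - 1 / 2)) - η * (riemannZeta (2 * (σ : ℂ)) / ((σ : ℂ) * riemannZeta σ)).re)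
        + A * (1 / (σ - 1 / 2)) + 2 * (A + 1) * x₂ * (1 / σ) := hh_val
    _ ≤ 2 * A / (σ - 1 / 2) - η * (riemannZeta (2 * (σ : ℂ)) / ((σ : ℂ) * riemannZeta σ)).re
        + 4 * (A + 1) * x₂ := by
        have : A * (1 / (σ - 1 / 2)) + A * (1 / (σ - 1 / 2)) = 2 * A / (σ - 1 / 2) := by ring
        linarith

end OneSided

/-! ## The residue of `ζ(2s)/(sζ(s))` at `s = ½` as a real limit -/

/-- `u · ζ(1+2u) / ((½+u) ζ(½+u)) → 1/ζ(½)` as `u → 0⁺` (real `u`): the residue of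
`F(s) = ζ(2s)/(sζ(s))` at the pole `s = ½` of `ζ(2s)` is `(½)/(½ ζ(½)) = 1/ζ(½)` (Borwein–
Ferguson–Mossinghoff (4): the constant term `1/ζ(1/2)` of `A*_m`). From Mathlib's
`riemannZeta_residue_one`. [cite: BorweinFergusonMossinghoff2008, §1 (4) p. 1683] -/
theorem tendsto_mul_zetaQuot_real :
    Tendsto (fun u : ℝ ↦ (u : ℂ) * (riemannZeta (2 * ((1 / 2 + u : ℝ) : ℂ)) /
      ((((1 / 2 + u : ℝ)) : ℂ) * riemannZeta ((1 / 2 + u : ℝ) : ℂ))))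
      (𝓝[>] 0) (𝓝 (1 / riemannZeta (1 / 2))) := by
  -- `2u ζ(1+2u) → 1`
  have h1 : Tendsto (fun u : ℝ ↦ (1 + 2 * (u : ℂ))) (𝓝[>] 0) (𝓝[≠] 1) := by
    refine tendsto_nhdsWithin_iff.2 ⟨?_, ?_⟩
    · have : Continuous fun u : ℝ ↦ (1 + 2 * (u : ℂ)) := by fun_prop
      have := this.tendsto 0
      simp only [Complex.ofReal_zero, mul_zero, add_zero] at this
      exact this.mono_left nhdsWithin_le_nhds
    · filter_upwards [self_mem_nhdsWithin] with u (hu : 0 < u)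
      simp only [mem_compl_iff, mem_singleton_iff, add_eq_left, mul_eq_zero, OfNat.ofNat_ne_zero,
        Complex.ofReal_eq_zero, false_or]
      exact hu.ne'
  have hres : Tendsto (fun u : ℝ ↦ (2 * (u : ℂ)) * riemannZeta (1 + 2 * (u : ℂ))) (𝓝[>] 0) (𝓝 1) := by
    have := riemannZeta_residue_one.comp h1
    refine this.congr fun u ↦ ?_
    simp only [Function.comp_apply]
    ring_nf
  -- `(½+u) ζ(½+u) → ½ ζ(½) ≠ 0`
  have hcont : ContinuousAt (fun z : ℂ ↦ z * riemannZeta z) (1 / 2) :=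
    continuousAt_id.mul (differentiableAt_riemannZeta (by norm_num)).continuousAt
  have h2 : Tendsto (fun u : ℝ ↦ (((1 / 2 + u : ℝ)) : ℂ)) (𝓝[>] 0) (𝓝 (1 / 2)) := by
    have hc : Continuous fun u : ℝ ↦ (((1 / 2 + u : ℝ)) : ℂ) := by fun_prop
    have := hc.tendsto 0
    have h0 : (((1 / 2 + (0 : ℝ) : ℝ)) : ℂ) = 1 / 2 := by push_cast; ring
    rw [h0] at this
    exact this.mono_left nhdsWithin_le_nhds
  have hden : Tendsto (fun u : ℝ ↦ (((1 / 2 + u : ℝ)) : ℂ) * riemannZeta ((1 / 2 + u : ℝ) : ℂ))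
      (𝓝[>] 0) (𝓝 ((1 / 2 : ℂ) * riemannZeta (1 / 2))) :=
    hcont.tendsto.comp h2
  have hne : (1 / 2 : ℂ) * riemannZeta (1 / 2) ≠ 0 := by
    refine mul_ne_zero (by norm_num) ?_
    have := riemannZeta_ofReal_ne_zero_of_pos_of_lt_one (1 / 2) (by norm_num) (by norm_num)
    push_cast at this
    exact this
  have hquot := (hres.div hden hne)
  have hlim : (1 : ℂ) / ((1 / 2 : ℂ) * riemannZeta (1 / 2)) * (1 / 2) = 1 / riemannZeta (1 / 2) := by
    field_simp
  rw [← hlim]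
  refine (hquot.mul_const (1 / 2 : ℂ)).congr' ?_
  filter_upwards [self_mem_nhdsWithin] with u (_hu : 0 < u)
  have h2u : 2 * ((((1 / 2 + u : ℝ)) : ℂ)) = 1 + 2 * (u : ℂ) := by push_cast; ring
  simp only [Pi.div_apply]
  rw [h2u]
  ring

/-! ## The strong corollary: simple zeros and bounded residues -/

section StrongCorollary

variable {A x₁ η : ℝ}

/-- **One-sided bound ⟹ zeros on the line, simple, with bounded residues** (Landau's theorem,
Strong Corollary, for `L`; Ingham 1942 as printed by BFM 2008 §1 p. 1682 for the simplicity). If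
`ηL(x) ≤ A√x` for `x ≥ x₁` (`η = ±1`, `A ≥ 0`), then every zero `ρ` of `ζ` with `0 < Re ρ < 1`
satisfies `Re ρ = ½`, `ζ'(ρ) ≠ 0`, and `‖ζ(2ρ)/(ρζ'(ρ))‖ ≤ 2A − η/ζ(½)` — the coefficient of
`x^ρ` in the explicit formula for `L` is bounded uniformly in `ρ` (Anderson–Stark, proof of Thm. 1:
"Again by Landau's theorem, we may assume `r_γ = O(1)`").
[cite: AndersonStark1981, §2 (Strong Corollary) and §4 Theorem 1 (proof)]
[cite: BorweinFergusonMossinghoff2008, §1 (p. 1682)] -/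
theorem liouville_oneSided_zeros (hη : η = 1 ∨ η = -1) (hA : 0 ≤ A)
    (hb : ∀ x, x₁ ≤ x → η * (liouvilleSum x : ℝ) ≤ A * Real.sqrt x)
    {ρ : ℂ} (hζ : riemannZeta ρ = 0) (h0 : 0 < ρ.re) (h1 : ρ.re < 1) :
    ρ.re = 1 / 2 ∧ deriv riemannZeta ρ ≠ 0 ∧
      ‖riemannZeta (2 * ρ) / (ρ * deriv riemannZeta ρ)‖ ≤ 2 * A - η * (1 / riemannZeta (1 / 2)).re := by
  have hI : ∀ σ : ℝ, 1 / 2 < σ →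
      IntegrableOn (fun x ↦ (liouvilleSum x : ℝ) * x ^ (-(σ + 1))) (Ioi 1) :=
    fun σ hσ ↦ integrableOn_liouville_rpow_of_oneSided hη hb hσ
  -- (a) `Re ρ = ½` (Landau and the functional equation, `LiouvilleOneSidedSimpleZeros.lean`)
  have hre : ρ.re = 1 / 2 := zetaZero_re_eq_half_of_liouville_oneSided hη hb hζ h0 h1
  -- `ρ ≠ 1`, `Im ρ ≠ 0`, `ζ(2ρ) ≠ 0`
  have hρ1 : ρ ≠ 1 := by
    intro h; rw [h] at h1; simp at h1
  have him : ρ.im ≠ 0 := by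
    intro him0
    have hρeq : ρ = ((1 / 2 : ℝ) : ℂ) := by
      apply Complex.ext <;> simp [hre, him0]
    rw [hρeq] at hζ
    exact riemannZeta_ofReal_ne_zero_of_pos_of_lt_one (1 / 2) (by norm_num) (by norm_num) hζ
  have h2ρre : (2 * ρ).re = 1 := by simp [hre]
  have hζ2ρ : riemannZeta (2 * ρ) ≠ 0 := riemannZeta_ne_zero_of_one_le_re (by rw [h2ρre])
  -- notation along the horizontal approach `s = ρ + u`
  set F : ℂ → ℂ := Landau.mellinIoi (fun x ↦ (liouvilleSum x : ℝ)) with hF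
  set x₂ : ℝ := max x₁ 1 with hx₂
  set C₁ : ℝ := 4 * (A + 1) * x₂ with hC₁
  set R : ℝ → ℝ := fun u ↦ (riemannZeta (2 * ((1 / 2 + u : ℝ) : ℂ)) /
    ((((1 / 2 + u : ℝ)) : ℂ) * riemannZeta ((1 / 2 + u : ℝ) : ℂ))).re with hR
  set Φ : ℝ → ℝ := fun u ↦ (2 * A - η * (u * R u) + C₁ * u) * ‖ρ + u‖ *
    (‖riemannZeta (ρ + u)‖ / u) with hΦ
  -- the inequality `‖ζ(2(ρ+u))‖ ≤ Φ(u)` for `0 < u < ½`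
  have hineq : ∀ u : ℝ, 0 < u → u < 1 / 2 → ‖riemannZeta (2 * (ρ + u))‖ ≤ Φ u := by
    intro u hu hu2
    set s : ℂ := ρ + u with hs
    have hsre : s.re = 1 / 2 + u := by simp [hs, hre]
    have hs1 : 1 / 2 < s.re := by rw [hsre]; linarith
    have hs2 : s.re < 1 := by rw [hsre]; linarith
    have hsne1 : s ≠ 1 := by
      intro h; have := congrArg Complex.im h; simp [hs] at this; exact him this
    have hmul : F s * (s * riemannZeta s) = riemannZeta (2 * s) := mellin_liouville_mul_eq hI hs1 hsne1
    have hnb := norm_mellin_liouville_le_of_oneSided_from hη hA hb hs1 hs2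
    rw [hsre] at hnb
    have hRu : (riemannZeta (2 * ((1 / 2 + u : ℝ) : ℂ)) /
        ((((1 / 2 + u : ℝ)) : ℂ) * riemannZeta ((1 / 2 + u : ℝ) : ℂ))).re = R u := rfl
    rw [hRu, show (1 / 2 + u - 1 / 2 : ℝ) = u by ring] at hnb
    -- `‖ζ(2s)‖ = ‖F s‖ ‖s‖ ‖ζ s‖`
    have hnorm2 : ‖riemannZeta (2 * s)‖ = ‖F s‖ * ‖s‖ * ‖riemannZeta s‖ := by
      rw [← hmul, norm_mul, norm_mul, mul_assoc]
    rw [hnorm2]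
    have hkey : ‖F s‖ ≤ (2 * A - η * (u * R u) + C₁ * u) / u := by
      rw [le_div_iff₀ hu]
      have hu0 : u ≠ 0 := hu.ne'
      have hdiv : 2 * A / u * u = 2 * A := div_mul_cancel₀ _ hu0
      have : (2 * A / u - η * R u + C₁) * u = 2 * A - η * (u * R u) + C₁ * u := by
        calc (2 * A / u - η * R u + C₁) * u = 2 * A / u * u - η * (u * R u) + C₁ * u := by ring
          _ = 2 * A - η * (u * R u) + C₁ * u := by rw [hdiv]
      rw [← this]
      exact mul_le_mul_of_nonneg_right hnb hu.le
    calc ‖F s‖ * ‖s‖ * ‖riemannZeta s‖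
        ≤ (2 * A - η * (u * R u) + C₁ * u) / u * ‖s‖ * ‖riemannZeta s‖ := by
          gcongr
    _ = Φ u := by
          simp only [hΦ, hs]
          ring
  -- limits as `u → 0⁺`
  have hlim_lhs : Tendsto (fun u : ℝ ↦ ‖riemannZeta (2 * (ρ + u))‖) (𝓝[>] 0)
      (𝓝 ‖riemannZeta (2 * ρ)‖) := by
    have h2ρ1 : 2 * ρ ≠ 1 := by
      intro h; have := congrArg Complex.im h; simp at this; exact him this
    have hc : ContinuousAt (fun z : ℂ ↦ ‖riemannZeta (2 * z)‖) ρ :=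
      ((differentiableAt_riemannZeta h2ρ1).continuousAt.comp
        (continuousAt_const.mul continuousAt_id)).norm
    have hpath : Tendsto (fun u : ℝ ↦ ρ + (u : ℂ)) (𝓝[>] 0) (𝓝 ρ) := by
      have : Continuous fun u : ℝ ↦ ρ + (u : ℂ) := by fun_prop
      have := this.tendsto 0
      simp only [Complex.ofReal_zero, add_zero] at this
      exact this.mono_left nhdsWithin_le_nhds
    exact hc.tendsto.comp hpath
  have hlim_uR : Tendsto (fun u : ℝ ↦ u * R u) (𝓝[>] 0) (𝓝 (1 / riemannZeta (1 / 2)).re) := by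
    have h := (Complex.continuous_re.tendsto _).comp tendsto_mul_zetaQuot_real
    refine h.congr fun u ↦ ?_
    simp only [Function.comp_apply, hR, Complex.re_ofReal_mul]
  have hlim_coef : Tendsto (fun u : ℝ ↦ 2 * A - η * (u * R u) + C₁ * u) (𝓝[>] 0)
      (𝓝 (2 * A - η * (1 / riemannZeta (1 / 2)).re)) := by
    have h3 : Tendsto (fun u : ℝ ↦ C₁ * u) (𝓝[>] 0) (𝓝 0) := by
      have : Tendsto (fun u : ℝ ↦ C₁ * u) (𝓝 0) (𝓝 (C₁ * 0)) :=
        tendsto_const_nhds.mul tendsto_id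
      rw [mul_zero] at this
      exact this.mono_left nhdsWithin_le_nhds
    have := ((tendsto_const_nhds (x := 2 * A)).sub (hlim_uR.const_mul η)).add h3
    simpa using this
  have hlim_norm : Tendsto (fun u : ℝ ↦ ‖ρ + (u : ℂ)‖) (𝓝[>] 0) (𝓝 ‖ρ‖) := by
    have : Continuous fun u : ℝ ↦ ‖ρ + (u : ℂ)‖ := by fun_prop
    have := this.tendsto 0
    simp only [Complex.ofReal_zero, add_zero] at this
    exact this.mono_left nhdsWithin_le_nhds
  have hlim_slope : Tendsto (fun u : ℝ ↦ ‖riemannZeta (ρ + u)‖ / u) (𝓝[>] 0)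
      (𝓝 ‖deriv riemannZeta ρ‖) := by
    have hd : HasDerivAt riemannZeta (deriv riemannZeta ρ) ρ :=
      (differentiableAt_riemannZeta hρ1).hasDerivAt
    rw [hasDerivAt_iff_tendsto_slope] at hd
    have hpath : Tendsto (fun u : ℝ ↦ ρ + (u : ℂ)) (𝓝[>] 0) (𝓝[≠] ρ) := by
      refine tendsto_nhdsWithin_iff.2 ⟨?_, ?_⟩
      · have : Continuous fun u : ℝ ↦ ρ + (u : ℂ) := by fun_prop
        have := this.tendsto 0
        simp only [Complex.ofReal_zero, add_zero] at this
        exact this.mono_left nhdsWithin_le_nhds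
      · filter_upwards [self_mem_nhdsWithin] with u (hu : 0 < u)
        simp only [mem_compl_iff, mem_singleton_iff, add_eq_left, Complex.ofReal_eq_zero]
        exact hu.ne'
    have h := (hd.comp hpath).norm
    refine h.congr' ?_
    filter_upwards [self_mem_nhdsWithin] with u (hu : 0 < u)
    simp only [Function.comp_apply, slope_def_field, hζ, sub_zero, add_sub_cancel_left, norm_div,
      Complex.norm_real, Real.norm_eq_abs, abs_of_pos hu]
  have hlim_rhs : Tendsto Φ (𝓝[>] 0)
      (𝓝 ((2 * A - η * (1 / riemannZeta (1 / 2)).re) * ‖ρ‖ * ‖deriv riemannZeta ρ‖)) :=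
    (hlim_coef.mul hlim_norm).mul hlim_slope
  have hev : ∀ᶠ u : ℝ in 𝓝[>] 0, ‖riemannZeta (2 * (ρ + (u : ℂ)))‖ ≤ Φ u := by
    filter_upwards [Ioo_mem_nhdsGT (show (0 : ℝ) < 1 / 2 by norm_num)] with u hu
    exact hineq u hu.1 hu.2
  have hfinal : ‖riemannZeta (2 * ρ)‖ ≤
      (2 * A - η * (1 / riemannZeta (1 / 2)).re) * ‖ρ‖ * ‖deriv riemannZeta ρ‖ :=
    le_of_tendsto_of_tendsto hlim_lhs hlim_rhs hev
  -- conclusions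
  have hpos : 0 < ‖riemannZeta (2 * ρ)‖ := norm_pos_iff.2 hζ2ρ
  have hρ0 : ρ ≠ 0 := by
    intro h; rw [h] at h0; simp at h0
  have hd : deriv riemannZeta ρ ≠ 0 := by
    intro hd0
    rw [hd0, norm_zero, mul_zero] at hfinal
    linarith
  refine ⟨hre, hd, ?_⟩
  rw [norm_div, norm_mul, div_le_iff₀ (by positivity)]
  calc ‖riemannZeta (2 * ρ)‖ ≤ (2 * A - η * (1 / riemannZeta (1 / 2)).re) * ‖ρ‖ * ‖deriv riemannZeta ρ‖ :=
        hfinal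
    _ = (2 * A - η * (1 / riemannZeta (1 / 2)).re) * (‖ρ‖ * ‖deriv riemannZeta ρ‖) := by ring

/-- **The zero clause at every height** under a one-sided bound on `L`: the hypothesis `hzeros`
of Ingham's kernel theorem for `ζ(1+2s)q(s)/ζ(½+s)`
(`Literature.NumberTheory.LFunctions.zetaQuot_frequently_gt_and_lt`, `ZetaQuotientKernelTheorem.lean`)
holds for every `T` (Anderson–Stark, proof of Thm. 1: "By Landau's theorem, we may assume …").
[cite: AndersonStark1981, §4 Theorem 1 (proof)] -/
theorem liouville_oneSided_zeros_below (hη : η = 1 ∨ η = -1) (hA : 0 ≤ A)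
    (hb : ∀ x, x₁ ≤ x → η * (liouvilleSum x : ℝ) ≤ A * Real.sqrt x) (T : ℝ) :
    ∀ ρ : ℂ, riemannZeta ρ = 0 → 0 < ρ.re → ρ.re < 1 → |ρ.im| < T →
      ρ.re = 1 / 2 ∧ deriv riemannZeta ρ ≠ 0 :=
  fun _ hζ h0 h1 _ ↦
    ⟨(liouville_oneSided_zeros hη hA hb hζ h0 h1).1, (liouville_oneSided_zeros hη hA hb hζ h0 h1).2.1⟩

/-- **Uniform residue bound** under a one-sided bound on `L`: for every zero `ρ` of `ζ` in the
critical strip, `‖ζ(2ρ)/(ρζ'(ρ))‖ ≤ 2A − η/ζ(½)` ("we may assume `r_γ = O(1)`", Anderson–Stark,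
proof of Thm. 1). [cite: AndersonStark1981, §4 Theorem 1 (proof)] -/
theorem liouville_oneSided_residue_le (hη : η = 1 ∨ η = -1) (hA : 0 ≤ A)
    (hb : ∀ x, x₁ ≤ x → η * (liouvilleSum x : ℝ) ≤ A * Real.sqrt x)
    {ρ : ℂ} (hζ : riemannZeta ρ = 0) (h0 : 0 < ρ.re) (h1 : ρ.re < 1) :
    ‖riemannZeta (2 * ρ) / (ρ * deriv riemannZeta ρ)‖ ≤ 2 * A - η * (1 / riemannZeta (1 / 2)).re :=
  (liouville_oneSided_zeros hη hA hb hζ h0 h1).2.2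

end StrongCorollary

end Literature.NumberTheory.LFunctions
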